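import Summits.CriticalPhenomena.PercolationContinuityZ3.Theorems.PercNearOneGluingNoHeavyLowerTailCILGlueBridgeBlock
import Summits.CriticalPhenomena.PercolationContinuityZ3.Theorems.PercNearOneGluingNoHeavyLowerTailCILReachClosureAlgebra
import Summits.CriticalPhenomena.PercolationContinuityZ3.Theorems.PercNearOneGluingNoHeavyLowerTailAbsorptionGluedPairAnyWeight
import HarnessLib

/-!
# `NoHeavyLowerTail` (stmt-CriticalPhenomena-4575) — the CELL inequality of the overtaking bound, in closure form

Support file (prover `prim-hp-3`, hull-port line; `--supports stmt-CriticalPhenomena-4575`).  No definitions, no named facts, no sorries.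
Step 3 of the assembly recipe (run/shared/lean/prim/prim-hp-3/PROOF-OVERTAKING-BOUND.md §6–§7).  For a weight `K`, relays `A`, level `j`, two
NONEMPTY blocks `T, S` with chosen roots `rT ∈ T`, `rS ∈ S`, and vertices `i, x`, write `R₂ = (Reach^T)^S` (two-block closure, orientation
`R a b ∨ ((∃ t ∈ B, R a t) ∧ ∃ t ∈ B, R t b)`) and `R₁ = Reach^{T ∪ S}`.  Honest weights: `W` = `K` with the stars `rT–(T∖rT)` and `rS–(S∖rS)` set to
weight one (`Hyperedge.real_twoBlock_reachFunctional`: `μ_W{Φ(Reach)} = μ_K{Φ(R₂)}` for every functional `Φ`), and `W[s(rT,rS) ↦ 1]` realises `R₁`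
(`Hyperedge.real_mergedBlock_reachFunctional`).  Consequently (`Hyperedge.overtaking_cell`):

  `μ_K{|{z : R₁ i z}| ≤ j} − μ_K{|{z : R₁ rT z}| ≤ j}  ≥  μ_K{|{z : R₂ i z}| ≤ j} − max(μ_K{|{z : R₂ rT z}| ≤ j}, μ_K{|{z : R₂ rS z}| ≤ j})`

— the glued-pair margin bound `HullPort.lightness_margin_glue_ge_max_any` transported to closures.  With `Hyperedge.sepMargin_eq_closure_sub` (L1) and
`reachClosure_root_iff` (L3) the left side is the Step-1 cell `f(T,S)` and the right side is `c_i − max(ℓ_T, ℓ_S)` of §7.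
-/

noncomputable section

namespace Summit.CriticalPhenomena.PercolationContinuityZ3.Theorems

open MeasureTheory Set Literature.Probability.LatticeModels Literature.Probability.Percolation
open scoped Classical BigOperators

variable {n : ℕ}

namespace Hyperedge

/-- **Two blocks as honest weights.**  For roots `rT ∈ T`, `rS ∈ S` let `W` be `K` with the pairs `s(rT,t)` (`t ∈ T ∖ rT`) and then `s(rS,s)`
(`s ∈ S ∖ rS`) raised to weight one.  Then for every reachability functional `Φ`: `μ_W{Φ(Reach)} = μ_K{Φ((Reach^T)^S)}`. [folklore] -/
theorem real_twoBlock_reachFunctional (K : Sym2 (Fin n) → unitInterval) (T S : Finset (Fin n)) {rT rS : Fin n}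
    (hrT : rT ∈ T) (hrS : rS ∈ S) (Φ : (Fin n → Fin n → Prop) → Prop) :
    (prodBernoulli ((S.erase rS).toList.foldr (fun s w' => Function.update w' s(rS, s) 1)
        ((T.erase rT).toList.foldr (fun t w' => Function.update w' s(rT, t) 1) K))).real
        {ω : BondConfig (Fin n) | Φ fun a b => (openGraph ω).Reachable a b} =
      (prodBernoulli K).real {ω : BondConfig (Fin n) |
        Φ fun a b =>
          ((openGraph ω).Reachable a b ∨
              ((∃ t ∈ T, (openGraph ω).Reachable a t) ∧ ∃ t ∈ T, (openGraph ω).Reachable t b)) ∨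
            ((∃ s ∈ S, (openGraph ω).Reachable a s ∨
                ((∃ t ∈ T, (openGraph ω).Reachable a t) ∧ ∃ t ∈ T, (openGraph ω).Reachable t s)) ∧
              ∃ s ∈ S, (openGraph ω).Reachable s b ∨
                ((∃ t ∈ T, (openGraph ω).Reachable s t) ∧ ∃ t ∈ T, (openGraph ω).Reachable t b))} := by
  have hLS : ∀ s ∈ (S.erase rS).toList, s ≠ rS := fun s hs => (Finset.mem_erase.1 (Finset.mem_toList.1 hs)).1
  have hLT : ∀ t ∈ (T.erase rT).toList, t ≠ rT := fun t ht => (Finset.mem_erase.1 (Finset.mem_toList.1 ht)).1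
  have hST : insert rS (S.erase rS).toList.toFinset = S := by
    rw [Finset.toList_toFinset, Finset.insert_erase hrS]
  have hTT : insert rT (T.erase rT).toList.toFinset = T := by
    rw [Finset.toList_toFinset, Finset.insert_erase hrT]
  -- outer block S over the weight with T already glued
  rw [real_glueList_reachFunctional _ rS _ hLS Φ, hST]
  -- inner block T, with the functional composed with the S-closure
  have key := real_glueList_reachFunctional K rT _ hLT (fun R => Φ fun a b => R a b ∨
    ((∃ s ∈ S, R a s) ∧ ∃ s ∈ S, R s b))
  beta_reduce at key
  rw [hTT] at key
  exact key

/-- **Merging the two blocks is one more weight-one pair.**  With `W` as in `real_twoBlock_reachFunctional`: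
`μ_{W[s(rT,rS) ↦ 1]}{Φ(Reach)} = μ_K{Φ(Reach^{T ∪ S})}`. [folklore] -/
theorem real_mergedBlock_reachFunctional (K : Sym2 (Fin n) → unitInterval) (T S : Finset (Fin n)) {rT rS : Fin n}
    (hrT : rT ∈ T) (hrS : rS ∈ S) (hne : rT ≠ rS) (Φ : (Fin n → Fin n → Prop) → Prop) :
    (prodBernoulli (Function.update ((S.erase rS).toList.foldr (fun s w' => Function.update w' s(rS, s) 1)
        ((T.erase rT).toList.foldr (fun t w' => Function.update w' s(rT, t) 1) K)) s(rT, rS) 1)).real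
        {ω : BondConfig (Fin n) | Φ fun a b => (openGraph ω).Reachable a b} =
      (prodBernoulli K).real {ω : BondConfig (Fin n) |
        Φ fun a b => (openGraph ω).Reachable a b ∨
          ((∃ t ∈ T ∪ S, (openGraph ω).Reachable a t) ∧ ∃ t ∈ T ∪ S, (openGraph ω).Reachable t b)} := by
  rw [real_update_one_reachFunctional _ hne Φ]
  have key := real_twoBlock_reachFunctional K T S hrT hrS (fun R => Φ fun a b => R a b ∨
    ((∃ ρ ∈ ({rT, rS} : Finset (Fin n)), R a ρ) ∧ ∃ ρ ∈ ({rT, rS} : Finset (Fin n)), R ρ b))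
  beta_reduce at key
  rw [key]
  congr 1
  ext ω
  simp only [mem_setOf_eq]
  have hrel : (fun a b => (((openGraph ω).Reachable a b ∨
        ((∃ t ∈ T, (openGraph ω).Reachable a t) ∧ ∃ t ∈ T, (openGraph ω).Reachable t b)) ∨
      ((∃ s ∈ S, (openGraph ω).Reachable a s ∨ ((∃ t ∈ T, (openGraph ω).Reachable a t) ∧ ∃ t ∈ T, (openGraph ω).Reachable t s)) ∧
        ∃ s ∈ S, (openGraph ω).Reachable s b ∨ ((∃ t ∈ T, (openGraph ω).Reachable s t) ∧ ∃ t ∈ T, (openGraph ω).Reachable t b))) ∨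
      ((∃ ρ ∈ ({rT, rS} : Finset (Fin n)), (((openGraph ω).Reachable a ρ ∨
          ((∃ t ∈ T, (openGraph ω).Reachable a t) ∧ ∃ t ∈ T, (openGraph ω).Reachable t ρ)) ∨
        ((∃ s ∈ S, (openGraph ω).Reachable a s ∨ ((∃ t ∈ T, (openGraph ω).Reachable a t) ∧ ∃ t ∈ T, (openGraph ω).Reachable t s)) ∧
          ∃ s ∈ S, (openGraph ω).Reachable s ρ ∨ ((∃ t ∈ T, (openGraph ω).Reachable s t) ∧ ∃ t ∈ T, (openGraph ω).Reachable t ρ)))) ∧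
        ∃ ρ ∈ ({rT, rS} : Finset (Fin n)), (((openGraph ω).Reachable ρ b ∨
          ((∃ t ∈ T, (openGraph ω).Reachable ρ t) ∧ ∃ t ∈ T, (openGraph ω).Reachable t b)) ∨
        ((∃ s ∈ S, (openGraph ω).Reachable ρ s ∨ ((∃ t ∈ T, (openGraph ω).Reachable ρ t) ∧ ∃ t ∈ T, (openGraph ω).Reachable t s)) ∧
          ∃ s ∈ S, (openGraph ω).Reachable s b ∨ ((∃ t ∈ T, (openGraph ω).Reachable s t) ∧ ∃ t ∈ T, (openGraph ω).Reachable t b))))) =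
      fun a b => (openGraph ω).Reachable a b ∨
        ((∃ t ∈ T ∪ S, (openGraph ω).Reachable a t) ∧ ∃ t ∈ T ∪ S, (openGraph ω).Reachable t b) := by
    funext a b
    exact propext (reachClosure_merge_iff _ (fun a => SimpleGraph.Reachable.refl a) T S hrT hrS a b)
  rw [hrel]

/-- **The overtaking cell inequality (closure form).**  For nonempty blocks with roots `rT ∈ T`, `rS ∈ S`, `rT ≠ rS`, and any vertex `i`:
`μ_K{|{z : R₂ i z}| ≤ j} − max(μ_K{|{z : R₂ rT z}| ≤ j}, μ_K{|{z : R₂ rS z}| ≤ j}) ≤ μ_K{|{z : R₁ i z}| ≤ j} − μ_K{|{z : R₁ rT z}| ≤ j}`,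
`R₂ = (Reach^T)^S`, `R₁ = Reach^{T∪S}` — `HullPort.lightness_margin_glue_ge_max_any` read through the glue bridges. [this file] -/
theorem overtaking_cell (K : Sym2 (Fin n) → unitInterval) (A T S : Finset (Fin n)) {rT rS : Fin n}
    (hrT : rT ∈ T) (hrS : rS ∈ S) (hne : rT ≠ rS) (i : Fin n) (j : ℕ) :
    (prodBernoulli K).real {ω : BondConfig (Fin n) | (A.filter fun z =>
          ((openGraph ω).Reachable i z ∨ ((∃ t ∈ T, (openGraph ω).Reachable i t) ∧ ∃ t ∈ T, (openGraph ω).Reachable t z)) ∨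
            ((∃ s ∈ S, (openGraph ω).Reachable i s ∨ ((∃ t ∈ T, (openGraph ω).Reachable i t) ∧ ∃ t ∈ T, (openGraph ω).Reachable t s)) ∧
              ∃ s ∈ S, (openGraph ω).Reachable s z ∨ ((∃ t ∈ T, (openGraph ω).Reachable s t) ∧ ∃ t ∈ T, (openGraph ω).Reachable t z))).card ≤ j} -
        max ((prodBernoulli K).real {ω : BondConfig (Fin n) | (A.filter fun z =>
          ((openGraph ω).Reachable rT z ∨ ((∃ t ∈ T, (openGraph ω).Reachable rT t) ∧ ∃ t ∈ T, (openGraph ω).Reachable t z)) ∨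
            ((∃ s ∈ S, (openGraph ω).Reachable rT s ∨ ((∃ t ∈ T, (openGraph ω).Reachable rT t) ∧ ∃ t ∈ T, (openGraph ω).Reachable t s)) ∧
              ∃ s ∈ S, (openGraph ω).Reachable s z ∨ ((∃ t ∈ T, (openGraph ω).Reachable s t) ∧ ∃ t ∈ T, (openGraph ω).Reachable t z))).card ≤ j})
          ((prodBernoulli K).real {ω : BondConfig (Fin n) | (A.filter fun z =>
          ((openGraph ω).Reachable rS z ∨ ((∃ t ∈ T, (openGraph ω).Reachable rS t) ∧ ∃ t ∈ T, (openGraph ω).Reachable t z)) ∨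
            ((∃ s ∈ S, (openGraph ω).Reachable rS s ∨ ((∃ t ∈ T, (openGraph ω).Reachable rS t) ∧ ∃ t ∈ T, (openGraph ω).Reachable t s)) ∧
              ∃ s ∈ S, (openGraph ω).Reachable s z ∨ ((∃ t ∈ T, (openGraph ω).Reachable s t) ∧ ∃ t ∈ T, (openGraph ω).Reachable t z))).card ≤ j}) ≤
      (prodBernoulli K).real {ω : BondConfig (Fin n) | (A.filter fun z => (openGraph ω).Reachable i z ∨
          ((∃ t ∈ T ∪ S, (openGraph ω).Reachable i t) ∧ ∃ t ∈ T ∪ S, (openGraph ω).Reachable t z)).card ≤ j} -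
        (prodBernoulli K).real {ω : BondConfig (Fin n) | (A.filter fun z => (openGraph ω).Reachable rT z ∨
          ((∃ t ∈ T ∪ S, (openGraph ω).Reachable rT t) ∧ ∃ t ∈ T ∪ S, (openGraph ω).Reachable t z)).card ≤ j} := by
  set W := (S.erase rS).toList.foldr (fun s w' => Function.update w' s(rS, s) 1)
    ((T.erase rT).toList.foldr (fun t w' => Function.update w' s(rT, t) 1) K) with hW
  -- every closure lightness is an honest lightness in `W` or `W[s(rT,rS) ↦ 1]`
  have two := fun v : Fin n => real_twoBlock_reachFunctional K T S hrT hrS (fun R => (A.filter fun z => R v z).card ≤ j)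
  have one := fun v : Fin n => real_mergedBlock_reachFunctional K T S hrT hrS hne (fun R => (A.filter fun z => R v z).card ≤ j)
  have h2i := two i; have h2T := two rT; have h2S := two rS; have h1i := one i; have h1T := one rT
  beta_reduce at h2i h2T h2S h1i h1T
  have key := HullPort.lightness_margin_glue_ge_max_any W A rT rS i j hne
  rw [← hW] at h2i h2T h2S h1i h1T
  -- identify each closure lightness with an honest lightness (instances of `Finset.filter` differ only by `Subsingleton`)
  have a1 : (prodBernoulli K).real {ω : BondConfig (Fin n) | (A.filter fun z =>
          ((openGraph ω).Reachable i z ∨ ((∃ t ∈ T, (openGraph ω).Reachable i t) ∧ ∃ t ∈ T, (openGraph ω).Reachable t z)) ∨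
            ((∃ s ∈ S, (openGraph ω).Reachable i s ∨ ((∃ t ∈ T, (openGraph ω).Reachable i t) ∧ ∃ t ∈ T, (openGraph ω).Reachable t s)) ∧
              ∃ s ∈ S, (openGraph ω).Reachable s z ∨ ((∃ t ∈ T, (openGraph ω).Reachable s t) ∧ ∃ t ∈ T, (openGraph ω).Reachable t z))).card ≤ j} =
      (prodBernoulli W).real {ω : BondConfig (Fin n) | (A.filter fun x => ω ∈ openConn i x).card ≤ j} := by
    convert h2i.symm using 3
    rfl
  have a2 : (prodBernoulli K).real {ω : BondConfig (Fin n) | (A.filter fun z =>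
          ((openGraph ω).Reachable rT z ∨ ((∃ t ∈ T, (openGraph ω).Reachable rT t) ∧ ∃ t ∈ T, (openGraph ω).Reachable t z)) ∨
            ((∃ s ∈ S, (openGraph ω).Reachable rT s ∨ ((∃ t ∈ T, (openGraph ω).Reachable rT t) ∧ ∃ t ∈ T, (openGraph ω).Reachable t s)) ∧
              ∃ s ∈ S, (openGraph ω).Reachable s z ∨ ((∃ t ∈ T, (openGraph ω).Reachable s t) ∧ ∃ t ∈ T, (openGraph ω).Reachable t z))).card ≤ j} =
      (prodBernoulli W).real {ω : BondConfig (Fin n) | (A.filter fun x => ω ∈ openConn rT x).card ≤ j} := by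
    convert h2T.symm using 3
    rfl
  have a3 : (prodBernoulli K).real {ω : BondConfig (Fin n) | (A.filter fun z =>
          ((openGraph ω).Reachable rS z ∨ ((∃ t ∈ T, (openGraph ω).Reachable rS t) ∧ ∃ t ∈ T, (openGraph ω).Reachable t z)) ∨
            ((∃ s ∈ S, (openGraph ω).Reachable rS s ∨ ((∃ t ∈ T, (openGraph ω).Reachable rS t) ∧ ∃ t ∈ T, (openGraph ω).Reachable t s)) ∧
              ∃ s ∈ S, (openGraph ω).Reachable s z ∨ ((∃ t ∈ T, (openGraph ω).Reachable s t) ∧ ∃ t ∈ T, (openGraph ω).Reachable t z))).card ≤ j} =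
      (prodBernoulli W).real {ω : BondConfig (Fin n) | (A.filter fun x => ω ∈ openConn rS x).card ≤ j} := by
    convert h2S.symm using 3
    rfl
  have b1 : (prodBernoulli K).real {ω : BondConfig (Fin n) | (A.filter fun z => (openGraph ω).Reachable i z ∨
          ((∃ t ∈ T ∪ S, (openGraph ω).Reachable i t) ∧ ∃ t ∈ T ∪ S, (openGraph ω).Reachable t z)).card ≤ j} =
      (prodBernoulli (Function.update W s(rT, rS) 1)).real
        {ω : BondConfig (Fin n) | (A.filter fun x => ω ∈ openConn i x).card ≤ j} := by
    convert h1i.symm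
    exact Iff.rfl
  have b2 : (prodBernoulli K).real {ω : BondConfig (Fin n) | (A.filter fun z => (openGraph ω).Reachable rT z ∨
          ((∃ t ∈ T ∪ S, (openGraph ω).Reachable rT t) ∧ ∃ t ∈ T ∪ S, (openGraph ω).Reachable t z)).card ≤ j} =
      (prodBernoulli (Function.update W s(rT, rS) 1)).real
        {ω : BondConfig (Fin n) | (A.filter fun x => ω ∈ openConn rT x).card ≤ j} := by
    convert h1T.symm
    exact Iff.rfl
  rw [a1, a2, a3, b1, b2]
  exact key

end Hyperedge

end Summit.CriticalPhenomena.PercolationContinuityZ3.Theorems
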